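import Summits.BirchSwinnertonDyer.BirchSwinnertonDyer.Theorems.ManinLocalTwoThreeShimuraQuotientAtkinLehnerParity
import Summits.BirchSwinnertonDyer.BirchSwinnertonDyer.Theorems.ManinLocalTwoThreeAtkinLehnerShimuraSignLaw
import Summits.BirchSwinnertonDyer.Rank1Residual.ManinAdditive.ShimuraIndexAtkinLehnerProofs
import Literature.NumberTheory.EllipticCurves.AtkinLehnerFrickeLevelProofs
import Mathlib.RingTheory.ZMod.UnitsCyclic
import HarnessLib

/-!
# THE SHIMURA KERNEL OF EVERY NEWFORM QUOTIENT IS CYCLIC UP TO AN ELEMENTARY 2-GROUP — part 1 of 2 (§1–§6)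
(route `ManinLocalTwoThree`, crux C3 `ManinPrimeToThreeAtNine` stmt-BirchSwinnertonDyer-22968 — structure of the Shimura `ℓ`-kernel at additive level;
cell bsd-f2-manin, LENS imc gen 40, MEMO-imc §52 / NOTE-52 (HOME/imc/g40/, source `ManinLocalTwoThreeShimuraQuotientCyclic.lean` sha16 f3fa9a583428a19f,
TURNKEY T-imc-52, split into two files ≤ 400 lines and landed by the prover seat p1 gen 25); `--supports stmt-BirchSwinnertonDyer-22968`; sequel to
`…ShimuraQuotientAtkinLehnerParity` and `…AtkinLehnerShimuraSignLaw`.  THIS PART: §1–§6 (the odd part: 52.C, 52.5, 52.6 and the one-generator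
lemmas); part 2 (`…ShimuraQuotientCyclicTwo`): §7–§9 (CRT lifts, the `2`-power minus divisor, THEOREM 52.A, the closed-form laws).)

THE MECHANISM.  `θ : (ℤ/N)ˣ ↠ Λ₀(f)/Λ₁(f)`, `θ(d_γ) = {∞, γ∞}_f`, satisfies `θ(−d) = θ(d)` and, for `Q ∥ N` with `w_Q f = ε_Q f`, `θ(d*) = −ε_Q θ(d)`
(`d* ≡ d (mod Q)`, `≡ d⁻¹ (mod N/Q)`; tree `SigmaHabitat.exists_atkinLehner_companion`).  Hence (§1) for `w_Q f = −f` the doubled character `2θ`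
FACTORS THROUGH `(ℤ/Q)ˣ`; (§7′) `w_N f = +f ⟹ 2Λ₀ ⊆ Λ₁`; (§7) two coprime minus divisors ⟹ `2Λ₀ ⊆ Λ₁`; (§2) one minus divisor `Q` with `(ℤ/Q)ˣ/±1`
cyclic ⟹ `2·(Λ₀/Λ₁)` has ONE generator (odd prime powers: Mathlib `ZMod.isCyclic_units_of_prime_pow`; `Q = 2^v`: `(ℤ/2^v)ˣ = ±⟨5⟩`, proved here).
THEOREMS (fact-free, hypotheses `IsNewform0 f` only): **52.A** `twoShimuraQuotientCyclic_of_newform` — `2·(Λ₀(f)/Λ₁(f))` is CYCLIC for every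
newform; **52.A′** `fricke_neg_and_unique_minus_of_not_two_mul_le` — `¬ 2Λ₀ ⊆ Λ₁ ⟹ w_N f = −f` and at most one Atkin–Lehner-minus prime;
**52.C** `oddShimuraQuotientCyclic_of_newform` — `(Λ₀/Λ₁) ⊗ 𝔽_ℓ` is cyclic for every odd prime `ℓ` (the ODD PART of `Λ₀/Λ₁` is cyclic);
52.5 `oddKernel_rank_le_one_of_newform` (`t_ℓ ≤ 1` at a traceless prime); 52.6 `gamma1Periods_not_in_oddMultiple_of_newform` (`Λ₁ ⊄ ℓΛ₀`).
DICTIONARY (NOTE-52 §0, paper): for a newform `f` of any dimension `d` and one complex embedding, `H₁(A_f,ℤ) ≅ Λ₀(f)` and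
`λ_* H₁(A_f^{(1)},ℤ) ≅ Λ₁(f)`, so `ker(λ : A_f^{(1)} → A_f) ≅ Λ₀(f)/Λ₁(f) ≅ ℤ/n ⊕ (ℤ/2)^r` for EVERY newform quotient of `J₀(N)`.

HONEST FRAMING.  Unconditional theorems about the tree's period lattices of a bare newform; the Props `TwoShimuraQuotientCyclic`,
`OddShimuraQuotientCyclic`, `Gamma1PeriodsNotInOddMultiple` are DISCHARGED here for every newform (`OddShimuraKernelRankLeOne` at traceless primes);
C2/C3 (OPEN ⟸ CDT), Manin's conjecture and BSD are NOT proved.  No named facts, no sorry.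
[cite: AtkinLehner1970, §2 Lemmas 8–10, Thm. 3 (w_Q normalises Γ₀(N); newforms are w_Q- and w_N-eigen with sign ±1)]
[cite: Manin1972, Prop. 1.4 / Thm. 1.6 (Manin symbols generate; the cusp character)]
-/

set_option autoImplicit false
-- lint-debt: the directory name repeats the summit name (sibling precedent `ManinLocalTwoThreeShimuraQuotientAtkinLehnerParity.lean`)
set_option linter.dupNamespace false

noncomputable section

open scoped MatrixGroups ModularForm
open CongruenceSubgroup
open Literature.NumberTheory.EllipticCurves Literature.NumberTheory.EllipticCurves.ModularForms
open Summit.BirchSwinnertonDyer.Rank1Residual.ManinAdditive.KatoCurve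
open Summit.BirchSwinnertonDyer.BirchSwinnertonDyer.Theorems.ManinLocalTwoThree
open Summit.BirchSwinnertonDyer.BirchSwinnertonDyer.Theorems.ManinLocalTwoThree.SigmaHabitat

namespace Summit.BirchSwinnertonDyer.BirchSwinnertonDyer.Theorems.ManinLocalTwoThree.ShimuraQuotientCyclic

variable {N : ℕ} [NeZero N] (f : CuspForm (Gamma0 N) 2) (Q : ℕ) [NeZero Q]

/-! ### §1  `w_Q f = −f` ⟹ `2θ(d)` depends only on `d mod Q` -/

/-- **§52.1 (FACTORIZATION, PROVED).** `Q ∥ N`, `w_Q f = −f`, `d_γ ≡ d_{γ'} (mod Q)` ⟹ `2({∞,γ'∞} − {∞,γ∞}) ∈ Λ₁(f)`.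
Proof: choose `δ ∈ Γ₀(N)` with `d_δ ≡ d_{γ'} a_γ (mod N)`; then `d_δ ≡ 1 (mod Q)` so `2{∞,δ∞} ∈ Λ₁` (tree, Atkin–Lehner-minus
half of the parity law), and `d_{γδ} ≡ d_{γ'} (mod N)` so `{∞,γ'∞} − {∞,γδ∞} ∈ Λ₁`. -/
theorem two_mul_sub_mem_of_atkinLehner_minus_of_castEq (hQN : Q ∣ N) (hc : Nat.Coprime Q (N / Q)) (hQ : 1 < Q)
    (hε : atkinLehnerInvolution N 2 Q f = (-1 : ℂ) • f) (γ γ' : Gamma0 N)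
    (h : ((((γ : SL(2, ℤ)) 1 1 : ℤ)) : ZMod Q) = ((((γ' : SL(2, ℤ)) 1 1 : ℤ)) : ZMod Q)) :
    2 * (cuspSymbol f γ' - cuspSymbol f γ) ∈ periodLatticeGamma1 f := by
  have hadN := gamma0_apply_zero_zero_mul_apply_one_one γ (dvd_refl N)
  have hadQ := gamma0_apply_zero_zero_mul_apply_one_one γ hQN
  have haunit : IsUnit ((((γ : SL(2, ℤ)) 0 0 : ℤ) : ZMod N)) := IsUnit.of_mul_eq_one _ hadN
  have hunit : IsUnit (((((γ' : SL(2, ℤ)) 1 1 : ℤ) * ((γ : SL(2, ℤ)) 0 0 : ℤ) : ℤ) : ZMod N)) := by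
    push_cast
    exact (isUnit_apply_one_one γ').mul haunit
  obtain ⟨δ, hδ⟩ := exists_gamma0_apply_one_one_eq_of_isUnit hunit
  -- `d_δ ≡ 1 (mod Q)`
  have hδQ : ((((δ : SL(2, ℤ)) 1 1 : ℤ)) : ZMod Q) = 1 := by
    have e := congrArg (ZMod.castHom hQN (ZMod Q)) hδ
    rw [map_intCast, map_intCast] at e
    rw [e]; push_cast
    rw [← h, mul_comm]; exact hadQ
  have hdvd : (Q : ℤ) ∣ ((δ : SL(2, ℤ)) 1 1 : ℤ) - 1 := by
    rw [← ZMod.intCast_zmod_eq_zero_iff_dvd]; push_cast; rw [hδQ, sub_self]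
  have h2δ := two_mul_cuspSymbol_mem_periodLatticeGamma1_of_atkinLehner_minus f Q hQN hc hQ hε δ hdvd
  -- `d_{γδ} ≡ d_{γ'} (mod N)`
  have hγδ : cuspSymbol f γ' - cuspSymbol f (γ * δ) ∈ periodLatticeGamma1 f := by
    refine cuspSymbol_sub_mem_periodLatticeGamma1_of_apply_eq f (γ * δ) γ' ?_
    rw [gamma0_mul_apply_one_one γ δ (dvd_refl N), hδ]; push_cast
    linear_combination ((((γ' : SL(2, ℤ)) 1 1 : ℤ)) : ZMod N) * hadN
  rw [cuspSymbol_mul_holds f] at hγδ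
  have e2 : 2 * (cuspSymbol f γ' - cuspSymbol f γ)
      = ((cuspSymbol f γ' - (cuspSymbol f γ + cuspSymbol f δ)) + (cuspSymbol f γ' - (cuspSymbol f γ + cuspSymbol f δ)))
        + 2 * cuspSymbol f δ := by ring
  rw [e2]
  exact add_mem (add_mem hγδ hγδ) h2δ

omit [NeZero N] [NeZero Q] in
/-- `d_{γ^n} ≡ d_γ^n (mod m)` for `m ∣ N`. -/
theorem apply_one_one_pow_castEq (γ : Gamma0 N) {m : ℕ} (hm : m ∣ N) (n : ℕ) :
    (((((γ ^ n : Gamma0 N)) : SL(2, ℤ)) 1 1 : ℤ) : ZMod m) = (((((γ : SL(2, ℤ)) 1 1 : ℤ)) : ZMod m)) ^ n := by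
  induction n with
  | zero => simp
  | succ n ih => rw [pow_succ, gamma0_mul_apply_one_one _ _ hm, ih, pow_succ]

/-! ### §2  `2·(Λ₀/Λ₁)` is a quotient of `(ℤ/Q)ˣ`: ONE GENERATOR -/

/-- **§52.2 = E-imc-52a (CYCLICITY, PROVED).** `Q ∥ N`, `w_Q f = −f`, `(ℤ/Q)ˣ` cyclic (every odd prime power, Mathlib
`ZMod.isCyclic_units_of_prime_pow`) ⟹ there is ONE period `x₀ = {∞, γ₀∞}_f` with `2Λ₀(f) ⊆ ℤx₀ + Λ₁(f)`:
`2·(Λ₀(f)/Λ₁(f))` is cyclic, generated by the class of `x₀` (`d_{γ₀}` ≡ a generator of `(ℤ/Q)ˣ`). -/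
theorem exists_two_mul_sub_zsmul_mem_of_atkinLehner_minus [IsCyclic (ZMod Q)ˣ] (hQN : Q ∣ N)
    (hc : Nat.Coprime Q (N / Q)) (hQ : 1 < Q) (hε : atkinLehnerInvolution N 2 Q f = (-1 : ℂ) • f) :
    ∃ x₀ ∈ periodLattice f, ∀ z ∈ periodLattice f, ∃ k : ℤ, 2 * z - (k : ℂ) * x₀ ∈ periodLatticeGamma1 f := by
  obtain ⟨g, hg⟩ := IsCyclic.exists_generator (α := (ZMod Q)ˣ)
  obtain ⟨u, hu⟩ := ZMod.unitsMap_surjective hQN g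
  obtain ⟨γ₀, hγ₀⟩ := exists_gamma0_apply_one_one_eq_of_isUnit (Units.isUnit u)
  refine ⟨cuspSymbol f γ₀, cuspSymbol_mem_periodLattice f γ₀, fun z hz => ?_⟩
  have hz' : z ∈ (periodLattice f : Set ℂ) := hz
  rw [coe_periodLattice_eq_range] at hz'
  obtain ⟨γ, rfl⟩ := hz'
  have hdunit : IsUnit (((((γ : SL(2, ℤ)) 1 1 : ℤ)) : ZMod Q)) := by
    have h1 := gamma0_apply_zero_zero_mul_apply_one_one γ hQN
    exact IsUnit.of_mul_eq_one_right _ h1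
  obtain ⟨n, hn⟩ : ∃ n : ℕ, g ^ n = hdunit.unit := by
    have hmem : hdunit.unit ∈ Subgroup.zpowers g := hg _
    rw [← mem_powers_iff_mem_zpowers] at hmem
    exact (Submonoid.mem_powers_iff _ _).mp hmem
  have hcast : (((((γ₀ ^ n : Gamma0 N)) : SL(2, ℤ)) 1 1 : ℤ) : ZMod Q) = (((((γ : SL(2, ℤ)) 1 1 : ℤ)) : ZMod Q)) := by
    have h2 : (((((γ₀ : SL(2, ℤ)) 1 1 : ℤ)) : ZMod Q)) = ((g : (ZMod Q)ˣ) : ZMod Q) := by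
      have e := congrArg (ZMod.castHom hQN (ZMod Q)) hγ₀
      rw [map_intCast, ZMod.castHom_apply] at e
      rw [e, ← hu, ZMod.unitsMap_val]
    rw [apply_one_one_pow_castEq γ₀ hQN n, h2, ← Units.val_pow_eq_pow_val, hn, IsUnit.unit_spec]
  have key := two_mul_sub_mem_of_atkinLehner_minus_of_castEq f Q hQN hc hQ hε (γ₀ ^ n) γ hcast
  rw [cuspSymbol_pow_eq_natCast_mul] at key
  refine ⟨2 * n, ?_⟩
  push_cast
  convert key using 1
  ring

/-- **§52.2′ (odd prime powers).** The cyclicity hypothesis discharged for `Q = q^e`, `q` an odd prime. -/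
theorem exists_two_mul_sub_zsmul_mem_of_atkinLehner_minus_primePow {q e : ℕ} (hq : q.Prime) (hq2 : q ≠ 2)
    (he : 0 < e) (hQ : q ^ e = Q) (hQN : Q ∣ N) (hc : Nat.Coprime Q (N / Q))
    (hε : atkinLehnerInvolution N 2 Q f = (-1 : ℂ) • f) :
    ∃ x₀ ∈ periodLattice f, ∀ z ∈ periodLattice f, ∃ k : ℤ, 2 * z - (k : ℂ) * x₀ ∈ periodLatticeGamma1 f := by
  haveI : IsCyclic (ZMod Q)ˣ := hQ ▸ ZMod.isCyclic_units_of_prime_pow q hq hq2 e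
  have h1Q : 1 < Q := hQ ▸ Nat.one_lt_pow he.ne' hq.one_lt
  exact exists_two_mul_sub_zsmul_mem_of_atkinLehner_minus f Q hQN hc h1Q hε

omit [NeZero N] in
/-- **§52.2″ (ODD MODULUS: rank ≤ 1 of the `ℓ`-kernel, PROVED).** Under §52.2, for an odd prime `ℓ` any two periods
`x, y ∈ Λ₀(f)` admit `a, b ∈ ℤ`, not both `≡ 0 (mod ℓ)`, with `a x + b y ∈ Λ₁(f) + ℓΛ₀(f)`; i.e. `Λ₀/(Λ₁ + ℓΛ₀)` is
cyclic, `dim_{𝔽_ℓ} (Λ₀/Λ₁)[ℓ] ≤ 1`. -/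
theorem exists_combination_mem_of_generator {ℓ : ℕ} (hℓ : ℓ.Prime) (hℓ2 : ℓ ≠ 2)
    {x₀ : ℂ} (hx₀ : x₀ ∈ periodLattice f)
    (hgen : ∀ z ∈ periodLattice f, ∃ k : ℤ, 2 * z - (k : ℂ) * x₀ ∈ periodLatticeGamma1 f)
    {x y : ℂ} (hx : x ∈ periodLattice f) (hy : y ∈ periodLattice f) :
    ∃ a b : ℤ, ¬ ((ℓ : ℤ) ∣ a ∧ (ℓ : ℤ) ∣ b) ∧
      ∃ w ∈ periodLatticeGamma1 f, ∃ v ∈ periodLattice f, (a : ℂ) * x + (b : ℂ) * y = w + (ℓ : ℂ) * v := by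
  obtain ⟨kx, hkx⟩ := hgen x hx
  obtain ⟨ky, hky⟩ := hgen y hy
  have h2cop : IsCoprime (ℓ : ℤ) 2 := by
    have := Nat.isCoprime_iff_coprime.mpr ((Nat.coprime_primes hℓ Nat.prime_two).mpr hℓ2)
    simpa using this
  by_cases hdiv : (ℓ : ℤ) ∣ kx ∧ (ℓ : ℤ) ∣ ky
  · -- then `2x ∈ Λ₁ + ℓΛ₀`: take `(a, b) = (2, 0)`
    obtain ⟨m, hm⟩ := hdiv.1
    refine ⟨2, 0, ?_, 2 * x - (kx : ℂ) * x₀, hkx, (m : ℂ) * x₀, ?_, ?_⟩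
    · rintro ⟨h2, -⟩
      have h2' : ℓ ∣ 2 := by exact_mod_cast h2
      rcases (Nat.dvd_prime Nat.prime_two).mp h2' with h1 | h1
      · exact hℓ.one_lt.ne' h1
      · exact hℓ2 h1
    · rw [← zsmul_eq_mul]; exact (periodLattice f).zsmul_mem hx₀ m
    · rw [hm]; push_cast; ring
  · -- `2ky·x − 2kx·y = ky(2x − kx x₀) − kx(2y − ky x₀) ∈ Λ₁`
    refine ⟨2 * ky, -(2 * kx), ?_, (ky : ℂ) * (2 * x - (kx : ℂ) * x₀) - (kx : ℂ) * (2 * y - (ky : ℂ) * x₀), ?_,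
      0, zero_mem _, ?_⟩
    · rintro ⟨ha, hb⟩
      apply hdiv
      constructor
      · have : (ℓ : ℤ) ∣ 2 * kx := by simpa using (dvd_neg.mpr hb)
        exact h2cop.dvd_of_dvd_mul_left this
      · exact h2cop.dvd_of_dvd_mul_left ha
    · exact sub_mem (by rw [← zsmul_eq_mul]; exact (periodLatticeGamma1 f).zsmul_mem hkx ky)
        (by rw [← zsmul_eq_mul]; exact (periodLatticeGamma1 f).zsmul_mem hky kx)
    · push_cast; ring

/-! ### §3  Typed candidate Props (E-imc-52a … 52e); by the dictionary NOTE-52 §0 each is a statement about the Stevens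
isogeny `λ : A_f^{(1)} → A_f` of the newform quotient of ANY dimension (`ker λ ≅ Λ₀(f)/Λ₁(f)`, `Õ ≅ mult_ℝ Λ₀(f)`, `𝔛 ≅ {x : xΛ₁ ⊆ Λ₀}`). -/

/-- **E-imc-52a** (the content of §52.2, as a Prop over tree decls): `2·(Λ₀(f)/Λ₁(f))` is cyclic. PROVED above for every
`f` with an Atkin–Lehner-minus exact divisor `Q ∥ N`, `(ℤ/Q)ˣ` cyclic. -/
def TwoShimuraQuotientCyclic : Prop :=
  ∃ x₀ ∈ periodLattice f, ∀ z ∈ periodLattice f, ∃ k : ℤ, 2 * z - (k : ℂ) * x₀ ∈ periodLatticeGamma1 f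

/-- **E-imc-52b** (THEOREM-candidate, all newforms, all levels, every odd prime `ℓ`): the `ℓ`-torsion of the Shimura
quotient `Λ₀(f)/Λ₁(f)` (= `ker λ` for the newform quotient of any dimension) has `𝔽_ℓ`-rank ≤ 1.
Route to proof: `ℓ ∤ [Λ₀:Λ₁]` ⟹ trivial; else THEOREM AL gives the unique AL-minus prime `q`; `q` odd ⟹ §52.2′ + §52.2″;
`q = 2` ⟹ the Euler form `2φ(2^e)Λ₀ ⊆ Λ₁` (tree) makes `Λ₀/Λ₁` a 2-group. -/
def OddShimuraKernelRankLeOne (ℓ : ℕ) : Prop :=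
  ∀ x ∈ periodLattice f, ∀ y ∈ periodLattice f,
    (ℓ : ℂ) * x ∈ periodLatticeGamma1 f → (ℓ : ℂ) * y ∈ periodLatticeGamma1 f →
      ∃ a b : ℤ, ¬ ((ℓ : ℤ) ∣ a ∧ (ℓ : ℤ) ∣ b) ∧ (a : ℂ) * x + (b : ℂ) * y ∈ periodLatticeGamma1 f

/-- **E-imc-52c** (THEOREM-candidate, fact-free form of row 1♮-odd / E-es-189 for EVERY newform of every dimension):
the `Γ₁(N)`-periods never lie inside an ODD multiple of the `Γ₀(N)`-periods: `Λ₁(f) ⊄ ℓΛ₀(f)` for every odd prime `ℓ`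
(equivalently: the content `m₁(f)` is a power of 2; for `d = 1` and mod CDT: the Manin constant is a power of 2 WITHOUT Mazur's
theorem).  Needs `Λ₀(f)` of `ℤ`-rank ≥ 2 (a lattice) — stated with that as an explicit binder `hrk`. -/
def Gamma1PeriodsNotInOddMultiple (ℓ : ℕ) : Prop :=
  (∃ u ∈ periodLattice f, ∃ v ∈ periodLattice f,
      ∀ a b : ℤ, (∃ w ∈ periodLattice f, (a : ℂ) * u + (b : ℂ) * v = (ℓ : ℂ) * w) → (ℓ : ℤ) ∣ a ∧ (ℓ : ℤ) ∣ b) →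
    ¬ ∀ z ∈ periodLatticeGamma1 f, ∃ w ∈ periodLattice f, z = (ℓ : ℂ) * w

/-- **E-imc-52e = 51.A typed (PROVED from THEOREM W):** at a traceless prime `ℓ` (`T_ℓ f = 0`, e.g. `ℓ² ∣ N` for a newform)
`ℓΛ₀(f) ⊆ Λ₁(f)`, hence every `x` with `xΛ₁ ⊆ Λ₀` has `(ℓx)Λ₀ ⊆ Λ₀`: `ℓ𝔛 ⊆ Õ`, `𝔛/Õ` is killed by `ℓ`. -/
theorem mul_multiplier_of_traceless {ℓ : ℕ} [NeZero ℓ] (hℓ : ℓ.Prime) (hℓN : ℓ ∣ N)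
    (hT : heckeT (Gamma0 N) 2 ℓ f = (0 : ℂ) • f)
    {x : ℂ} (hx : ∀ z ∈ periodLatticeGamma1 f, x * z ∈ periodLattice f) :
    ∀ z ∈ periodLattice f, ((ℓ : ℂ) * x) * z ∈ periodLattice f := by
  intro z hz
  have h := heckeEigenPeriodCongruence_holds N ℓ f (0 : ℂ) hℓ hℓN hT z hz
  have hℓz : (ℓ : ℂ) * z ∈ periodLatticeGamma1 f := by
    have : ((0 : ℂ) - ℓ) * z = -((ℓ : ℂ) * z) := by ring
    rw [this] at h
    exact neg_mem_iff.mp h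
  have := hx _ hℓz
  convert this using 1; ring

/-! ### §4  NEWFORM COROLLARIES (THEOREM AL `atkinLehnerShimuraSignLaw_holds` supplies the minus prime; any coefficient field,
so — by the dictionary — any dimension `d`) -/

/-- **§52.4 (DICHOTOMY, PROVED).** `f` a newform, `ℓ` odd, `ℓ ∣ [Λ₀:Λ₁]`: either the unique Atkin–Lehner-minus prime `q` is odd
and `2·(Λ₀/Λ₁)` has ONE generator (§52.2′), or `q = 2` and `Λ₀/Λ₁` is a `2`-group (`2^{v₂(N)} Λ₀ ⊆ Λ₁`, Euler form). -/
theorem generator_or_twoGroup_of_newform (hf : IsNewform0 f) {ℓ : ℕ} (hℓ : ℓ.Prime) (hℓ2 : ℓ ≠ 2)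
    (hnot : ¬ ShimuraIndexPrimeTo ℓ f) :
    (∃ x₀ ∈ periodLattice f, ∀ z ∈ periodLattice f, ∃ k : ℤ, 2 * z - (k : ℂ) * x₀ ∈ periodLatticeGamma1 f) ∨
      (∀ z ∈ periodLattice f, ((2 ^ N.factorization 2 : ℕ) : ℂ) * z ∈ periodLatticeGamma1 f) := by
  obtain ⟨q, ⟨hq, hqN, hεq⟩, -⟩ := atkinLehnerShimuraSignLaw_holds N f hf ℓ hℓ hℓ2 hnot
  have hN0 : N ≠ 0 := NeZero.ne N
  have hkpos : 0 < N.factorization q := Nat.Prime.factorization_pos_of_dvd hq hN0 hqN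
  haveI : NeZero (q ^ N.factorization q) := ⟨pow_ne_zero _ hq.ne_zero⟩
  have hQN : q ^ N.factorization q ∣ N := Nat.ordProj_dvd N q
  have hcop : Nat.Coprime (q ^ N.factorization q) (N / q ^ N.factorization q) :=
    Nat.Coprime.pow_left _ (Nat.coprime_ordCompl hq hN0)
  have hinv : atkinLehnerInvolution N 2 (q ^ N.factorization q) f = (-1 : ℂ) • f :=
    atkinLehnerInvolution_eq_neg_of_eigenvalueAt f rfl hεq
  by_cases hq2 : q = 2
  · right
    subst hq2
    intro z hz
    have hz' : z ∈ (periodLattice f : Set ℂ) := hz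
    rw [coe_periodLattice_eq_range] at hz'
    obtain ⟨γ, rfl⟩ := hz'
    have h := totientMul_cuspSymbol_mem_of_atkinLehner_eq_neg hQN hcop f hinv γ
    have htot : 2 * (2 ^ N.factorization 2).totient = 2 ^ N.factorization 2 := by
      obtain ⟨j, hj⟩ : ∃ j, N.factorization 2 = j + 1 := ⟨N.factorization 2 - 1, by omega⟩
      rw [Nat.totient_prime_pow Nat.prime_two hkpos, hj, Nat.add_sub_cancel, pow_succ]
      norm_num [mul_comm]
    rwa [htot] at h
  · left
    exact exists_two_mul_sub_zsmul_mem_of_atkinLehner_minus_primePow f (q ^ N.factorization q) hq hq2 hkpos rfl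
      hQN hcop hinv

/-- **§52.5 = E-imc-52b AT A TRACELESS PRIME (PROVED): `t_ℓ ≤ 1`.** `f` a newform, `ℓ` odd with `T_ℓ f = 0` (e.g. `ℓ² ∣ N`):
any two periods are `𝔽_ℓ`-dependent modulo `Λ₁(f)`; with `ℓΛ₀ ⊆ Λ₁` (THEOREM W) this says the `ℓ`-part of `Λ₀(f)/Λ₁(f)`
(= `(ker λ)_ℓ` of the newform quotient of ANY dimension) is `0` or `ℤ/ℓ`.  Census: TABLE-49/50 rows `63, 117, 387 (ℓ=3), 275 (ℓ=5)`,
all `d = 2`, Smith form `[1,1,1,ℓ]`. -/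
theorem oddKernel_rank_le_one_of_newform (hf : IsNewform0 f) {ℓ : ℕ} [NeZero ℓ] (hℓ : ℓ.Prime) (hℓ2 : ℓ ≠ 2)
    (hℓN : ℓ ∣ N) (hT : heckeT (Gamma0 N) 2 ℓ f = (0 : ℂ) • f)
    {x y : ℂ} (hx : x ∈ periodLattice f) (hy : y ∈ periodLattice f) :
    ∃ a b : ℤ, ¬ ((ℓ : ℤ) ∣ a ∧ (ℓ : ℤ) ∣ b) ∧ (a : ℂ) * x + (b : ℂ) * y ∈ periodLatticeGamma1 f := by
  have hℓΛ : ∀ z ∈ periodLattice f, (ℓ : ℂ) * z ∈ periodLatticeGamma1 f := fun z hz => by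
    have h := heckeEigenPeriodCongruence_holds N ℓ f (0 : ℂ) hℓ hℓN hT z hz
    have e : ((0 : ℂ) - ℓ) * z = -((ℓ : ℂ) * z) := by ring
    rw [e] at h
    exact neg_mem_iff.mp h
  have hone : ¬ ((ℓ : ℤ) ∣ 1 ∧ (ℓ : ℤ) ∣ 0) := fun ⟨h1, _⟩ =>
    hℓ.one_lt.ne' (by exact_mod_cast Int.eq_one_of_dvd_one (by positivity) h1)
  by_cases hprime : ShimuraIndexPrimeTo ℓ f
  · exact ⟨1, 0, hone, by simpa using hprime x hx (hℓΛ x hx)⟩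
  · rcases generator_or_twoGroup_of_newform f hf hℓ hℓ2 hprime with ⟨x₀, hx₀, hgen⟩ | h2
    · obtain ⟨a, b, hab, w, hw, v, hv, e⟩ := exists_combination_mem_of_generator f hℓ hℓ2 hx₀ hgen hx hy
      exact ⟨a, b, hab, by rw [e]; exact add_mem hw (hℓΛ v hv)⟩
    · refine ⟨1, 0, hone, ?_⟩
      have hcop : Nat.Coprime (2 ^ N.factorization 2) ℓ :=
        ((Nat.coprime_primes Nat.prime_two hℓ).mpr (Ne.symm hℓ2)).pow_left _
      obtain ⟨u, v, huv⟩ := Nat.isCoprime_iff_coprime.mpr hcop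
      have e1 : x = (u : ℂ) * (((2 ^ N.factorization 2 : ℕ) : ℂ) * x) + (v : ℂ) * ((ℓ : ℂ) * x) := by
        have h := congrArg (fun t : ℤ => (t : ℂ)) huv
        push_cast at h ⊢
        linear_combination -x * h
      simp only [Int.cast_one, one_mul, Int.cast_zero, zero_mul, add_zero]
      rw [e1]
      exact add_mem (by rw [← zsmul_eq_mul]; exact (periodLatticeGamma1 f).zsmul_mem (h2 x hx) u)
        (by rw [← zsmul_eq_mul]; exact (periodLatticeGamma1 f).zsmul_mem (hℓΛ x hx) v)

/-- **THEOREM 52.C = E-imc-52b♮ (typed): the ODD PART of the Shimura quotient is CYCLIC.** `dim_{𝔽_ℓ} Λ₀(f)/(Λ₁(f) + ℓΛ₀(f)) ≤ 1`: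
any two periods `x, y ∈ Λ₀(f)` admit `a, b ∈ ℤ`, not both divisible by `ℓ`, with `a x + b y ∈ Λ₁(f) + ℓΛ₀(f)`.  For a finite abelian
group `G = Λ₀/Λ₁` this says `G/ℓG` is cyclic, i.e. the `ℓ`-primary part `G_ℓ` is cyclic (one elementary divisor).  By the dictionary
NOTE-52 §0, `G ≅ ker(λ : A_f^{(1)} → A_f) ≅ (A_f^∨ ∩ Σ(N))^D` for the newform quotient `A_f` of ANY dimension `d`. -/
def OddShimuraQuotientCyclic (ℓ : ℕ) : Prop :=
  ∀ x ∈ periodLattice f, ∀ y ∈ periodLattice f,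
    ∃ a b : ℤ, ¬ ((ℓ : ℤ) ∣ a ∧ (ℓ : ℤ) ∣ b) ∧
      ∃ w ∈ periodLatticeGamma1 f, ∃ v ∈ periodLattice f, (a : ℂ) * x + (b : ℂ) * y = w + (ℓ : ℂ) * v

/-- **THEOREM 52.C PROVED for EVERY newform `f ∈ S₂(Γ₀(N))` (any coefficient field, any level) and EVERY odd prime `ℓ`** — fact-free,
no datum, no optimality, no `T_ℓ`-hypothesis: the odd part of `Λ₀(f)/Λ₁(f)` is cyclic.  Proof: if `Λ₀/Λ₁` has no `ℓ`-torsion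
(`ShimuraIndexPrimeTo ℓ f`), strip the `ℓ`-part of `φ(N)` (`φ(N)Λ₀ ⊆ Λ₁`, `natMul_mem_of_shimuraIndexPrimeTo`) and use Bézout, so
`Λ₀ = Λ₁ + ℓΛ₀`; otherwise THEOREM AL (§52.4): either one period `x₀` generates `2(Λ₀/Λ₁)` (§52.2″ concludes), or `Λ₀/Λ₁` is a
`2`-group and again `Λ₀ = Λ₁ + ℓΛ₀` by Bézout.  For `d = 1` print has this via the Weil pairing (Vatsal 2005, Rem. 1.4/1.8: the Shimura
cover is étale over `ℤ[1/2]`) and the tree per DATUM via complex conjugation (`KummerValues.not_periodLatticeGamma1_le_natCast_mul_periodLattice`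
+ `ShimuraKernelCyclicLattice.cyclic_iff_forall_prime_not_le`, rank `2`); for `d ≥ 2` (rank `2d`, where `Λ₁ ⊄ ℓΛ₀` is strictly weaker than
cyclicity and the Weil pairing does not exclude `μ_ℓ² ⊂ A^∨`) it is new (NOTE-52 §5: searches). -/
theorem oddShimuraQuotientCyclic_of_newform (hf : IsNewform0 f) {ℓ : ℕ} (hℓ : ℓ.Prime) (hℓ2 : ℓ ≠ 2) :
    OddShimuraQuotientCyclic f ℓ := by
  intro x hx y hy
  have hone : ¬ ((ℓ : ℤ) ∣ 1 ∧ (ℓ : ℤ) ∣ 0) := fun ⟨h1, _⟩ =>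
    hℓ.one_lt.ne' (by exact_mod_cast Int.eq_one_of_dvd_one (by positivity) h1)
  -- the Bézout step: `m x ∈ Λ₁` with `m` prime to `ℓ` ⟹ `x ∈ Λ₁ + ℓΛ₀`, witnessed by `(a, b) = (1, 0)`
  have bezout : ∀ m : ℕ, Nat.Coprime m ℓ → (m : ℂ) * x ∈ periodLatticeGamma1 f →
      ∃ a b : ℤ, ¬ ((ℓ : ℤ) ∣ a ∧ (ℓ : ℤ) ∣ b) ∧
        ∃ w ∈ periodLatticeGamma1 f, ∃ v ∈ periodLattice f, (a : ℂ) * x + (b : ℂ) * y = w + (ℓ : ℂ) * v := by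
    intro m hcop hmx
    obtain ⟨u, v, huv⟩ := Nat.isCoprime_iff_coprime.mpr hcop
    refine ⟨1, 0, hone, (u : ℂ) * ((m : ℂ) * x), ?_, (v : ℂ) * x, ?_, ?_⟩
    · rw [← zsmul_eq_mul]; exact (periodLatticeGamma1 f).zsmul_mem hmx u
    · rw [← zsmul_eq_mul]; exact (periodLattice f).zsmul_mem hx v
    · have h := congrArg (fun t : ℤ => (t : ℂ)) huv
      push_cast at h ⊢
      linear_combination -x * h
  by_cases hprime : ShimuraIndexPrimeTo ℓ f
  · -- no `ℓ`-torsion: `φ(N) = ℓ^a m`, `ℓ ∤ m`, `m x ∈ Λ₁`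
    have hn : Nat.totient N ≠ 0 := (Nat.totient_pos.mpr (NeZero.pos N)).ne'
    obtain ⟨a, m, hndvd, hnm⟩ := Nat.exists_eq_pow_mul_and_not_dvd hn ℓ hℓ.one_lt.ne'
    refine bezout m (Nat.coprime_comm.mp ((Nat.Prime.coprime_iff_not_dvd hℓ).mpr hndvd)) ?_
    refine natMul_mem_of_shimuraIndexPrimeTo hprime hx a m ?_
    rw [← hnm]
    exact totient_mul_mem_periodLatticeGamma1 f hx
  · rcases generator_or_twoGroup_of_newform f hf hℓ hℓ2 hprime with ⟨x₀, hx₀, hgen⟩ | h2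
    · exact exists_combination_mem_of_generator f hℓ hℓ2 hx₀ hgen hx hy
    · exact bezout (2 ^ N.factorization 2) (((Nat.coprime_primes Nat.prime_two hℓ).mpr (Ne.symm hℓ2)).pow_left _)
        (h2 x hx)

/-- **§52.6 = E-imc-52c PROVED: `Λ₁(f) ⊄ ℓΛ₀(f)` for every newform `f` and every odd prime `ℓ`** (given two periods
independent mod `ℓ`, i.e. `Λ₀/ℓΛ₀` not cyclic — automatic for a lattice of rank `2d ≥ 2`).  For `d = 1` and mod CDT this is the
ODD HALF OF MANIN–STEVENS `c₁ = ±1 ⟹ c₀` a power of 2, WITHOUT Mazur's theorem; in the tree so far only modulo F★+Mazur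
(`…ShimuraKernelOddPart`) or ES+modularity+CES (`…ShimuraKernelCyclicNewform`). -/
theorem gamma1Periods_not_in_oddMultiple_of_newform (hf : IsNewform0 f) {ℓ : ℕ} (hℓ : ℓ.Prime) (hℓ2 : ℓ ≠ 2) :
    Gamma1PeriodsNotInOddMultiple f ℓ := by
  rintro ⟨u, hu, v, hv, hind⟩ hsub
  have hℓ1 : ¬ (ℓ : ℤ) ∣ 2 := fun h2 => by
    have h2' : ℓ ∣ 2 := by exact_mod_cast h2
    rcases (Nat.dvd_prime Nat.prime_two).mp h2' with h1 | h1
    · exact hℓ.one_lt.ne' h1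
    · exact hℓ2 h1
  -- from `c·u ∈ Λ₁ ⊆ ℓΛ₀` we get `ℓ ∣ c`
  have hdvd_of_mem : ∀ c : ℤ, (c : ℂ) * u ∈ periodLatticeGamma1 f → (ℓ : ℤ) ∣ c := fun c hc => by
    obtain ⟨w, hw, e⟩ := hsub _ hc
    exact (hind c 0 ⟨w, hw, by rw [← e]; push_cast; ring⟩).1
  by_cases hprime : ShimuraIndexPrimeTo ℓ f
  · -- `φ(N) = ℓ^a m`, `ℓ ∤ m`; `ℓ^a (m u) ∈ Λ₁` ⟹ `m u ∈ Λ₁` ⟹ `ℓ ∣ m`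
    have hN0 : N ≠ 0 := NeZero.ne N
    obtain ⟨a, m, hm, hφ⟩ := Nat.exists_eq_pow_mul_and_not_dvd (Nat.totient_pos.mpr (Nat.pos_of_ne_zero hN0)).ne' ℓ
      hℓ.one_lt.ne'
    have hpeel : ∀ (k : ℕ) (z : ℂ), z ∈ periodLattice f → ((ℓ ^ k : ℕ) : ℂ) * z ∈ periodLatticeGamma1 f →
        z ∈ periodLatticeGamma1 f := by
      intro k
      induction k with
      | zero => intro z _ hz; simpa using hz
      | succ k ih =>
        intro z hz hkz
        apply ih z hz
        refine hprime _ (by have h := (periodLattice f).nsmul_mem hz (ℓ ^ k); rwa [nsmul_eq_mul] at h) ?_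
        rw [pow_succ] at hkz; push_cast at hkz ⊢
        convert hkz using 1; ring
    have hmu : ((m : ℤ) : ℂ) * u ∈ periodLatticeGamma1 f := by
      refine hpeel a (((m : ℤ) : ℂ) * u) ?_ ?_
      · rw [← zsmul_eq_mul]; exact (periodLattice f).zsmul_mem hu m
      · have h := totient_mul_mem_periodLatticeGamma1 f hu
        rw [hφ] at h; push_cast at h ⊢
        convert h using 1; ring
    exact hm (by exact_mod_cast hdvd_of_mem m hmu)
  · rcases generator_or_twoGroup_of_newform f hf hℓ hℓ2 hprime with ⟨x₀, hx₀, hgen⟩ | h2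
    · obtain ⟨k₁, hk₁⟩ := hgen u hu
      obtain ⟨k₂, hk₂⟩ := hgen v hv
      obtain ⟨w₁, hw₁, e₁⟩ := hsub _ hk₁
      obtain ⟨w₂, hw₂, e₂⟩ := hsub _ hk₂
      -- `k₂·2u − k₁·2v = ℓ(k₂ w₁ − k₁ w₂)` ⟹ `ℓ ∣ 2k₂`, `ℓ ∣ 2k₁`
      have hk := hind (2 * k₂) (-(2 * k₁)) ⟨(k₂ : ℂ) * w₁ - (k₁ : ℂ) * w₂,
        sub_mem (by rw [← zsmul_eq_mul]; exact (periodLattice f).zsmul_mem hw₁ k₂)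
          (by rw [← zsmul_eq_mul]; exact (periodLattice f).zsmul_mem hw₂ k₁),
        by push_cast; linear_combination (k₂ : ℂ) * e₁ - (k₁ : ℂ) * e₂⟩
      have h2cop : IsCoprime (ℓ : ℤ) 2 := by
        have := Nat.isCoprime_iff_coprime.mpr ((Nat.coprime_primes hℓ Nat.prime_two).mpr hℓ2)
        simpa using this
      obtain ⟨k₁', hk₁'⟩ : (ℓ : ℤ) ∣ k₁ := h2cop.dvd_of_dvd_mul_left (by simpa using dvd_neg.mpr hk.2)
      -- then `2u = ℓ (k₁' x₀ + w₁)` ⟹ `ℓ ∣ 2`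
      refine hℓ1 (hind 2 0 ⟨(k₁' : ℂ) * x₀ + w₁,
        add_mem (by rw [← zsmul_eq_mul]; exact (periodLattice f).zsmul_mem hx₀ k₁') hw₁, ?_⟩).1
      rw [hk₁'] at e₁; push_cast at e₁ ⊢; linear_combination e₁
    · -- `2^e u ∈ Λ₁ ⊆ ℓΛ₀` ⟹ `ℓ ∣ 2^e` ⟹ `ℓ ∣ 2`
      have h := hdvd_of_mem ((2 ^ N.factorization 2 : ℕ) : ℤ) (by push_cast; simpa using h2 u hu)
      have h' : ℓ ∣ 2 ^ N.factorization 2 := by exact_mod_cast h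
      exact hℓ1 (by exact_mod_cast (Nat.Prime.dvd_of_dvd_pow hℓ h'))

end Summit.BirchSwinnertonDyer.BirchSwinnertonDyer.Theorems.ManinLocalTwoThree.ShimuraQuotientCyclic

end
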